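import Summits.NavierStokesRegularity.FunctionalMining.StretchingLaminateL1R18Defs
import HarnessLib

/-!
# FunctionalMining — K1-Q1 laminates, L1 port 5/18 — feature bounds, spectral form, (S1) far field W_nonneg_far, R18_S1near, R18_S1_of_near

search for candidate a priori estimates; no regularity claim.

Cell `pub-nsfunc` (host summit NavierStokesRegularity, topic `FunctionalMining`); PORT COPY of the bank seat's scratch
`HOME/pub-nsfunc-bank/tools/lam/upper/u4t/L1-SUPERSOLUTION.scratch.lean` (generic r11, sha16 c63cd257e1f26cb9), lines 1127–1423,
verbatim EXCEPT docstrings (overlay `u4t/port/docstrings_r11.json` c4f7e1e1d014a584 = split plan `u4t/PORT-SPLIT-PLAN.md` §4 (E2)/(E3):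
new one-line docstrings on formerly undocumented helpers + refreshed hypothesis/proved-downstream docstrings on the `Prop`s;
provenance tags `[ours; …]` appended to every other docstring (tags `u4t/port/tags_r11.json` 7935c0e35cdf68ee, census-2 port note P-B1);
bodies byte-identical to the scratch modulo docstrings — machine-verified by `split_r11.py --overlay`; census readings carry over).

CONTENT (sections `bounds`, `spectral`, `farS1`). Elementary feature bounds = Lemma E (b1)–(b4) of
`L3-S1-LEMMAS.md`: `pe_nonneg`, `pe_le_mSq` (via `expS_factor : e^{βM} = P·P`), `uF_bounds`;
spectral form on symmetric states (Mathlib `Matrix.IsHermitian.spectral_theorem`):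
`trace_eq_sum_eig`, `qF_eq_sum_eig_sq`, `Z_eq_sum_exp_eig`, `eig_bounds`, `eig_bounds_sqrt`,
`lse_bounds`, `log_three_le`. PROVED: the (S1) FAR FIELD `W_nonneg_far : 0 ≤ W_y` whenever
`tr Y² ≥ 601`, uniformly in `|x| ≤ 1` (the bound chain of `s1e.py`, margin 0.0187 at `√601`).
HYPOTHESIS: `R18_S1near` = (S1) on `tr Y² ≤ 601` (certificate j214521, Lemmas A–D). Glue
`R18_S1_of_near : R18_S1near → R18_S1`.

WORDS AT LANDING (LEAD (κκκκ)(iii)): records — conditional reduction: laminateSupConst ≤ theta1 GIVEN the two engine legs in the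
engines' own charts; (C-b) cell-union arithmetic and (C-c) per-box engine soundness are NOT in the kernel; ‹C_lam ≤ 0.78› NOT
claimed (L4/L5 by format, referee, LEAD-human gate); numbers of record unchanged.  Every `def … : Prop` named `R18_…` / `Row…` /
`…Rows…` below is a HYPOTHESIS = an engine-certified (or pen) claim, NOT proved in this file unless a `…_holds` theorem says so.
-/

noncomputable section

open Matrix

namespace Summit.NavierStokesRegularity.FunctionalMining

namespace Laminate

namespace R18

section bounds

/-! ### Elementary feature bounds (the dictionary facts (b1)–(b4) of Lemma E, `L3-S1-LEMMAS.md` / `s1e.py`,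
and of the far-field lemma): kernel lemmas for a future port of the pen legs.  Nothing of record. -/

/-- `e^{βM} = P·P` with `P = e^{(β/2)M}` symmetric and invertible, on symmetric `M`. [ours; elementary] -/
theorem expS_factor (β : ℝ) {M : Mat3} (h : M.IsSymm) :
    ∃ P : Mat3, P.IsSymm ∧ IsUnit P ∧ expS β M = P * P := by
  refine ⟨NormedSpace.exp ((β / 2) • M), (h.smul (β / 2)).exp, Matrix.isUnit_exp _, ?_⟩
  have hc : Commute ((β / 2) • M) ((β / 2) • M) := Commute.refl _
  have : β • M = (β / 2) • M + (β / 2) • M := by rw [← add_smul]; ring_nf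
  rw [expS, this, Matrix.exp_add_of_commute _ _ hc]

/-- `Z_β = Σ_ij P_ij²` for the factor `P` of `expS_factor`. [ours; elementary] -/
theorem Z_eq_sum_sq (β : ℝ) {M P : Mat3} (hPs : P.IsSymm) (hP : expS β M = P * P) :
    Z β M = ∑ i, ∑ j, P i j ^ 2 := by
  unfold Z
  rw [hP]
  simp only [Matrix.trace, Matrix.diag_apply, Matrix.mul_apply]
  refine Finset.sum_congr rfl fun i _ => Finset.sum_congr rfl fun j _ => ?_
  rw [hPs.apply i j, sq]

/-- Numerator of `pe_β` as a square: `xᵀe^{βM}x = |Px|²`. [ours; elementary] -/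
theorem dot_expS_mulVec_eq (β : ℝ) {M P : Mat3} (hPs : P.IsSymm) (hP : expS β M = P * P) (x : Vec3) :
    x ⬝ᵥ (expS β M *ᵥ x) = (P *ᵥ x) ⬝ᵥ (P *ᵥ x) := by
  rw [hP, ← Matrix.mulVec_mulVec, Matrix.dotProduct_mulVec]
  congr 1
  rw [← Matrix.vecMul_transpose, hPs.eq]

/-- Row-wise Cauchy–Schwarz: `|Px|² ≤ (Σ_ij P_ij²)·|x|²`. [ours; elementary] -/
theorem mulVec_dot_self_le (P : Mat3) (x : Vec3) :
    (P *ᵥ x) ⬝ᵥ (P *ᵥ x) ≤ (∑ i, ∑ j, P i j ^ 2) * (x ⬝ᵥ x) := by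
  have key : ∀ i, (P *ᵥ x) i * (P *ᵥ x) i ≤ (∑ j, P i j ^ 2) * (x ⬝ᵥ x) := fun i => by
    have h := Finset.sum_mul_sq_le_sq_mul_sq Finset.univ (fun j => P i j) x
    simp only [Matrix.mulVec, dotProduct, sq] at h ⊢
    exact h
  calc (P *ᵥ x) ⬝ᵥ (P *ᵥ x) = ∑ i, (P *ᵥ x) i * (P *ᵥ x) i := rfl
    _ ≤ ∑ i, (∑ j, P i j ^ 2) * (x ⬝ᵥ x) := Finset.sum_le_sum fun i _ => key i
    _ = (∑ i, ∑ j, P i j ^ 2) * (x ⬝ᵥ x) := by rw [Finset.sum_mul]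

/-- **(b1, lower)** `0 ≤ pe_β` on symmetric `M`. [ours; Lemma E (b1)] -/
theorem pe_nonneg (β : ℝ) (x : Vec3) {M : Mat3} (h : M.IsSymm) : 0 ≤ pe β x M := by
  obtain ⟨P, hPs, -, hP⟩ := expS_factor β h
  unfold pe
  refine div_nonneg ?_ (Z_pos β h).le
  rw [dot_expS_mulVec_eq β hPs hP]
  exact Finset.sum_nonneg fun i _ => mul_self_nonneg _

/-- **(b1, upper)** `pe_β ≤ m = |x|²` on symmetric `M` (`e^{βM} ≼ (tr e^{βM})·I`). [ours; Lemma E (b1)] -/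
theorem pe_le_mSq (β : ℝ) (x : Vec3) {M : Mat3} (h : M.IsSymm) : pe β x M ≤ mSq x := by
  obtain ⟨P, hPs, -, hP⟩ := expS_factor β h
  have hZ := Z_pos β h
  unfold pe mSq
  rw [div_le_iff₀ hZ, dot_expS_mulVec_eq β hPs hP, Z_eq_sum_sq β hPs hP, mul_comm]
  exact mulVec_dot_self_le P x

/-- **(b2)** `√q − 1/10 ≤ u ≤ √q` and `0 ≤ u` whenever `0 ≤ q` (in particular on symmetric `M`, `qF_nonneg`).
[ours; Lemma E (b2)] -/
theorem uF_bounds {M : Mat3} (hq : 0 ≤ qF M) :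
    Real.sqrt (qF M) - 1 / 10 ≤ uF M ∧ uF M ≤ Real.sqrt (qF M) ∧ 0 ≤ uF M := by
  unfold uF
  have h1 : Real.sqrt (qF M) ≤ Real.sqrt (qF M + 1 / 100) := Real.sqrt_le_sqrt (by linarith)
  have h2 : Real.sqrt (qF M + 1 / 100) ≤ Real.sqrt (qF M) + 1 / 10 := by
    rw [Real.sqrt_le_left (by positivity)]
    nlinarith [Real.sq_sqrt hq, Real.sqrt_nonneg (qF M)]
  have h3 : (1 / 10 : ℝ) ≤ Real.sqrt (qF M + 1 / 100) := by
    rw [show (1 / 10 : ℝ) = Real.sqrt (1 / 100) by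
      rw [show (1 / 100 : ℝ) = (1 / 10) ^ 2 by norm_num, Real.sqrt_sq (by norm_num)]]
    exact Real.sqrt_le_sqrt (by linarith)
  exact ⟨by linarith, by linarith, by linarith⟩

end bounds

section spectral

/-! ### Spectral form of the features on symmetric states: `q = Σλᵢ²`, `tr Y = Σλᵢ`, `Z_β = Σ e^{βλᵢ}`
(Mathlib's spectral theorem `Matrix.IsHermitian.spectral_theorem`), and the bounds (b3), (b4) of Lemma E. -/

/-- A real symmetric matrix is Hermitian (trivial star on `ℝ`). [ours; elementary] -/
theorem isHermitian_of_isSymm {M : Mat3} (h : M.IsSymm) : M.IsHermitian := by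
  rw [Matrix.IsHermitian, Matrix.conjTranspose_eq_transpose_of_trivial]; exact h

/-- `tr M = Σλᵢ`. [ours; elementary] -/
theorem trace_eq_sum_eig {M : Mat3} (h : M.IsSymm) :
    M.trace = ∑ i, (isHermitian_of_isSymm h).eigenvalues i := by
  have := (isHermitian_of_isSymm h).trace_eq_sum_eigenvalues
  simpa using this

/-- `q = tr M² = Σλᵢ²`. [ours; elementary] -/
theorem qF_eq_sum_eig_sq {M : Mat3} (h : M.IsSymm) :
    qF M = ∑ i, (isHermitian_of_isSymm h).eigenvalues i ^ 2 := by
  set hH := isHermitian_of_isSymm h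
  unfold qF
  rw [← sq]
  conv_lhs => rw [hH.spectral_theorem, ← map_pow, Unitary.conjStarAlgAut_apply, Matrix.trace_mul_cycle,
    Unitary.coe_star_mul_self, one_mul, Matrix.diagonal_pow, Matrix.trace_diagonal]
  simp

/-- `Z_β = tr e^{βM} = Σ e^{βλᵢ}`. [ours; elementary] -/
theorem Z_eq_sum_exp_eig (β : ℝ) {M : Mat3} (h : M.IsSymm) :
    Z β M = ∑ i, Real.exp (β * (isHermitian_of_isSymm h).eigenvalues i) := by
  set hH := isHermitian_of_isSymm h
  set U := hH.eigenvectorUnitary with hU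
  set V : (Mat3)ˣ := Unitary.toUnits U with hV
  have hVU : (V : Mat3) = (U : Mat3) := rfl
  have hVinv : ((V⁻¹ : (Mat3)ˣ) : Mat3) = star (U : Mat3) := by simp [hV]
  have hM : M = (U : Mat3) * Matrix.diagonal hH.eigenvalues * star (U : Mat3) := by
    conv_lhs => rw [hH.spectral_theorem, Unitary.conjStarAlgAut_apply]
    simp [hU]
  have hsmul : β • M = (V : Mat3) * Matrix.diagonal (fun i => β * hH.eigenvalues i) * ((V⁻¹ : (Mat3)ˣ) : Mat3) := by
    rw [hVU, hVinv]
    conv_lhs => rw [hM]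
    rw [← smul_mul_assoc, ← mul_smul_comm, ← Matrix.diagonal_smul]
    rfl
  have hexp : (NormedSpace.exp fun i => β * hH.eigenvalues i) = fun i => Real.exp (β * hH.eigenvalues i) :=
    funext fun i => by rw [Pi.coe_exp, Real.exp_eq_exp_ℝ]
  unfold Z expS
  rw [hsmul, Matrix.exp_units_conj, Matrix.exp_diagonal, hexp, Matrix.trace_mul_cycle, Units.inv_mul, one_mul,
    Matrix.trace_diagonal]

/-- **(b4)** On symmetric trace-free `M` with `q = tr M²`: every eigenvalue satisfies `λᵢ² ≤ 2q/3`, and some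
eigenvalue satisfies `0 ≤ λᵢ` and `q ≤ 6λᵢ²` (i.e. `√(q/6) ≤ λ_max ≤ √(2q/3)`). [ours; Lemma E (b4)] -/
theorem eig_bounds {M : Mat3} (h : M.IsSymm) (htr : M.trace = 0) :
    (∀ i, (isHermitian_of_isSymm h).eigenvalues i ^ 2 ≤ 2 / 3 * qF M) ∧
      ∃ i, 0 ≤ (isHermitian_of_isSymm h).eigenvalues i ∧ qF M ≤ 6 * (isHermitian_of_isSymm h).eigenvalues i ^ 2 := by
  set lam := (isHermitian_of_isSymm h).eigenvalues with hlam
  have hs : lam 0 + lam 1 + lam 2 = 0 := by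
    have := trace_eq_sum_eig h; rw [htr, Fin.sum_univ_three] at this; linarith
  have hq : qF M = lam 0 ^ 2 + lam 1 ^ 2 + lam 2 ^ 2 := by rw [qF_eq_sum_eig_sq h, Fin.sum_univ_three]
  refine ⟨fun i => ?_, ?_⟩
  · have hl0 : lam 0 = -(lam 1 + lam 2) := by linarith
    have k0 : lam 0 ^ 2 ≤ 2 / 3 * qF M := by rw [hq, hl0]; nlinarith [sq_nonneg (lam 1 - lam 2)]
    have k1 : lam 1 ^ 2 ≤ 2 / 3 * qF M := by rw [hq, hl0]; nlinarith [sq_nonneg (lam 1 + 2 * lam 2)]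
    have k2 : lam 2 ^ 2 ≤ 2 / 3 * qF M := by rw [hq, hl0]; nlinarith [sq_nonneg (2 * lam 1 + lam 2)]
    fin_cases i
    · exact k0
    · exact k1
    · exact k2
  · rcases le_total (lam 1) (lam 0) with h10 | h01
    · rcases le_total (lam 2) (lam 0) with h20 | h02
      · exact ⟨0, by linarith, by rw [hq]; nlinarith [mul_nonneg (sub_nonneg.2 h10) (sub_nonneg.2 h20)]⟩
      · exact ⟨2, by linarith, by rw [hq]; nlinarith [mul_nonneg (sub_nonneg.2 h02) (sub_nonneg.2 (h10.trans h02))]⟩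
    · rcases le_total (lam 2) (lam 1) with h21 | h12
      · exact ⟨1, by linarith, by rw [hq]; nlinarith [mul_nonneg (sub_nonneg.2 h01) (sub_nonneg.2 h21)]⟩
      · exact ⟨2, by linarith, by rw [hq]; nlinarith [mul_nonneg (sub_nonneg.2 (h01.trans h12)) (sub_nonneg.2 h12)]⟩

/-- (b4) in root form: `λᵢ ≤ √(2q/3)` for all `i`, and `√(q/6) ≤ λᵢ` for some `i`. [ours; Lemma E (b4)] -/
theorem eig_bounds_sqrt {M : Mat3} (h : M.IsSymm) (htr : M.trace = 0) :
    (∀ i, (isHermitian_of_isSymm h).eigenvalues i ≤ Real.sqrt (2 / 3 * qF M)) ∧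
      ∃ i, Real.sqrt (qF M / 6) ≤ (isHermitian_of_isSymm h).eigenvalues i := by
  obtain ⟨hup, i, hi0, hiq⟩ := eig_bounds h htr
  refine ⟨fun j => (le_abs_self _).trans (Real.abs_le_sqrt (hup j)), i, ?_⟩
  calc Real.sqrt (qF M / 6) ≤ Real.sqrt ((isHermitian_of_isSymm h).eigenvalues i ^ 2) :=
        Real.sqrt_le_sqrt (by linarith)
    _ = (isHermitian_of_isSymm h).eigenvalues i := Real.sqrt_sq hi0

/-- **(b3)** `λᵢ − (log 3)/β ≤ lse_β ≤ L` for every eigenvalue `λᵢ` and every upper bound `L` of the spectrum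
(`β > 0`). [ours; Lemma E (b3)] -/
theorem lse_bounds {β : ℝ} (hβ : 0 < β) {M : Mat3} (h : M.IsSymm) :
    (∀ i, (isHermitian_of_isSymm h).eigenvalues i - Real.log 3 / β ≤ lse β M) ∧
      ∀ L : ℝ, (∀ i, (isHermitian_of_isSymm h).eigenvalues i ≤ L) → lse β M ≤ L := by
  set lam := (isHermitian_of_isSymm h).eigenvalues with hlam
  have hZ : Z β M = Real.exp (β * lam 0) + Real.exp (β * lam 1) + Real.exp (β * lam 2) := by
    rw [Z_eq_sum_exp_eig β h, Fin.sum_univ_three]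
  have hZpos : 0 < Z β M := Z_pos β h
  have e0 := Real.exp_pos (β * lam 0)
  have e1 := Real.exp_pos (β * lam 1)
  have e2 := Real.exp_pos (β * lam 2)
  refine ⟨fun i => ?_, fun L hL => ?_⟩
  · -- exp(βλᵢ)/3 ≤ Z/3 ⇒ βλᵢ - log 3 ≤ log (Z/3)
    have hle : Real.exp (β * lam i) ≤ Z β M := by
      rw [hZ]; fin_cases i <;> simp <;> linarith
    have hlog : β * lam i - Real.log 3 ≤ Real.log (Z β M / 3) := by
      rw [Real.log_div hZpos.ne' (by norm_num), le_sub_iff_add_le, sub_add_cancel, ← Real.log_exp (β * lam i)]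
      exact Real.log_le_log (Real.exp_pos _) hle
    unfold lse
    rw [show lam i - Real.log 3 / β = β⁻¹ * (β * lam i - Real.log 3) by field_simp]
    exact mul_le_mul_of_nonneg_left hlog (inv_nonneg.2 hβ.le)
  · have hle : Z β M / 3 ≤ Real.exp (β * L) := by
      have m0 : Real.exp (β * lam 0) ≤ Real.exp (β * L) := Real.exp_le_exp.2 (by nlinarith [hL 0])
      have m1 : Real.exp (β * lam 1) ≤ Real.exp (β * L) := Real.exp_le_exp.2 (by nlinarith [hL 1])
      have m2 : Real.exp (β * lam 2) ≤ Real.exp (β * L) := Real.exp_le_exp.2 (by nlinarith [hL 2])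
      rw [hZ]; linarith
    have hlog : Real.log (Z β M / 3) ≤ β * L := by
      rw [← Real.log_exp (β * L)]
      exact Real.log_le_log (by positivity) hle
    unfold lse
    rw [show L = β⁻¹ * (β * L) by field_simp]
    exact mul_le_mul_of_nonneg_left hlog (inv_nonneg.2 hβ.le)

end spectral

section farS1

/-! ### (S1) in the far field, kernel version of Lemma E: `W_y ≥ 0` whenever `q = tr Y² ≥ 601` (uniform in `m ∈ [0,1]`;
the bound chain of `s1e.py` at its worst cell `m → 1`: A = y_q, B ≤ 0.20099, E ≤ 1.02476, margin 0.0187 at √601). -/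

/-- `log 3 ≤ 11/10` (from `e > 2.7182818283` and `1 + x + x²/2 ≤ eˣ`). [ours; elementary] -/
theorem log_three_le : Real.log 3 ≤ 11 / 10 := by
  rw [Real.log_le_iff_le_exp (by norm_num : (0 : ℝ) < 3)]
  have h1 : (2.7182818283 : ℝ) < Real.exp 1 := Real.exp_one_gt_d9
  have h2 : 1 + (1 / 10 : ℝ) + (1 / 10) ^ 2 / 2 ≤ Real.exp (1 / 10) := Real.quadratic_le_exp_of_nonneg (by norm_num)
  have h3 : Real.exp (11 / 10) = Real.exp 1 * Real.exp (1 / 10) := by rw [← Real.exp_add]; norm_num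
  rw [h3]; nlinarith [Real.exp_pos (1 / 10 : ℝ), Real.exp_pos (1 : ℝ)]

set_option maxHeartbeats 400000 in
/-- **(S1) FAR FIELD, kernel Lemma E for R18**: `0 ≤ W_y(x, Y)` for symmetric trace-free `Y` with `tr Y² ≥ 601` and `|x| ≤ 1`
— the `q ≥ 601` part of `R18_S1` (CERTIFICATE-MAP §2 row «(S1) far», there a pen lemma + `s1e.py`) is now a theorem.
Bound chain (all from sections `bounds`/`spectral`): `pe_β ∈ [0, m]`, `u ∈ [√q − 1/10, √q]`, `lse_β ∈ [λ_max − (log 3)/β, λ_max]`,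
`0.4082√q ≤ λ_max ≤ 0.8165√q`, `log 3 ≤ 1.1`; worst case `m = 1`. [ours; Lemma E, kernel] -/
theorem W_nonneg_far (x : Vec3) {Y : Mat3} (hY : Y.IsSymm) (htr : Y.trace = 0) (hx : x ⬝ᵥ x ≤ 1)
    (hq : 601 ≤ qF Y) : 0 ≤ W x Y := by
  -- atoms
  have hq0 : 0 ≤ qF Y := qF_nonneg hY
  set q := qF Y with hqdef
  set t := Real.sqrt q with htdef
  have ht0 : 0 ≤ t := Real.sqrt_nonneg _
  have ht2 : t * t = q := Real.mul_self_sqrt hq0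
  have ht : (24515 : ℝ) / 1000 ≤ t := by nlinarith
  have hm0 : 0 ≤ mSq x := by unfold mSq; exact Finset.sum_nonneg fun i _ => mul_self_nonneg _
  have hm1 : mSq x ≤ 1 := hx
  -- spectrum: L = λ_max
  set lam := (isHermitian_of_isSymm hY).eigenvalues with hlam
  obtain ⟨hup, i0, hlo⟩ := eig_bounds_sqrt hY htr
  set L := max (lam 0) (max (lam 1) (lam 2)) with hL
  have hκ : Real.sqrt (2 / 3 * q) ≤ 8165 / 10000 * t := by
    have : Real.sqrt (2 / 3 * q) ≤ Real.sqrt ((8165 / 10000 * t) ^ 2) := Real.sqrt_le_sqrt (by nlinarith)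
    rwa [Real.sqrt_sq (by positivity)] at this
  have hkl : 4082 / 10000 * t ≤ Real.sqrt (q / 6) := by
    have : Real.sqrt ((4082 / 10000 * t) ^ 2) ≤ Real.sqrt (q / 6) := Real.sqrt_le_sqrt (by nlinarith)
    rwa [Real.sqrt_sq (by positivity)] at this
  have hLi : ∀ i, lam i ≤ L := fun i => by
    fin_cases i
    · exact le_max_left _ _
    · exact le_max_of_le_right (le_max_left _ _)
    · exact le_max_of_le_right (le_max_right _ _)
  have hLup : L ≤ 8165 / 10000 * t :=
    max_le ((hup 0).trans hκ) (max_le ((hup 1).trans hκ) ((hup 2).trans hκ))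
  have hLlo : 4082 / 10000 * t ≤ L := hkl.trans (hlo.trans (hLi i0))
  have hLcases : L = lam 0 ∨ L = lam 1 ∨ L = lam 2 := by
    rw [hL]
    rcases le_total (lam 1) (lam 2) with h | h
    · rw [max_eq_right h]
      rcases le_total (lam 0) (lam 2) with h' | h'
      · rw [max_eq_right h']; exact Or.inr (Or.inr rfl)
      · rw [max_eq_left h']; exact Or.inl rfl
    · rw [max_eq_left h]
      rcases le_total (lam 0) (lam 1) with h' | h'
      · rw [max_eq_right h']; exact Or.inr (Or.inl rfl)
      · rw [max_eq_left h']; exact Or.inl rfl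
  -- lse bounds with the common λ_max
  have hlse : ∀ {β : ℝ}, 0 < β → L - Real.log 3 / β ≤ lse β Y ∧ lse β Y ≤ L := fun {β} hβ => by
    obtain ⟨hlow, hupp⟩ := lse_bounds hβ hY
    refine ⟨?_, hupp L hLi⟩
    rcases hLcases with h | h | h <;> rw [h] <;> exact hlow _
  have hl3 := log_three_le
  have hl3pos : 0 < Real.log 3 := Real.log_pos (by norm_num)
  obtain ⟨h1lo, h1hi⟩ := hlse (by norm_num : (0 : ℝ) < 1)
  obtain ⟨h4lo, h4hi⟩ := hlse (by norm_num : (0 : ℝ) < 4)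
  obtain ⟨h8lo, h8hi⟩ := hlse (by norm_num : (0 : ℝ) < 8)
  -- u and pe bounds
  obtain ⟨hulo, huhi, hu0⟩ := uF_bounds hq0
  have hp1 := pe_nonneg 1 x hY; have hp2 := pe_le_mSq 2 x hY
  have hp4 := pe_nonneg 4 x hY; have hp4' := pe_le_mSq 4 x hY
  have hp8 := pe_nonneg 8 x hY; have hp8' := pe_le_mSq 8 x hY
  have hp16 := pe_nonneg 16 x hY
  -- sign facts used for the products
  have hl1nn : 0 ≤ lse 1 Y := by rw [div_one] at h1lo; linarith
  have hl4nn : 0 ≤ lse 4 Y := by linarith [div_le_div_of_nonneg_left hl3pos.le (by norm_num : (0:ℝ) < 4) (by norm_num : (4:ℝ) ≤ 4)]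
  have hl8nn : 0 ≤ lse 8 Y := by
    have : Real.log 3 / 8 ≤ 11 / 80 := by linarith [div_le_div_of_nonneg_right hl3 (by norm_num : (0:ℝ) ≤ 8)]
    linarith
  have A1 : 0 ≤ (1 - mSq x) * q := mul_nonneg (by linarith) hq0
  have A2 : 0 ≤ (1 - mSq x) * lse 4 Y := mul_nonneg (by linarith) hl4nn
  have A3 : 0 ≤ (1 - mSq x) * lse 1 Y := mul_nonneg (by linarith) hl1nn
  have A4 : (1 - mSq x) * uF Y ≤ (1 - mSq x) * t := mul_le_mul_of_nonneg_left huhi (by linarith)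
  have A5 : 0 ≤ pe 8 x Y * lse 8 Y := mul_nonneg hp8 hl8nn
  have A6 : pe 4 x Y * uF Y ≤ mSq x * t := mul_le_mul hp4' huhi hu0 hm0
  have A7 : mSq x * t ≤ t := by nlinarith
  have A8 : mSq x ^ 2 ≤ mSq x := by nlinarith
  have A9 : (24515 : ℝ) / 1000 * t ≤ q := by nlinarith
  have h4q : Real.log 3 / 4 ≤ 11 / 40 := by linarith [div_le_div_of_nonneg_right hl3 (by norm_num : (0:ℝ) ≤ 4)]
  unfold W
  linarith

/-- **(S1) NEAR** — the machine part of (S1) that remains a hypothesis once the far field is a theorem: `0 ≤ W_y` on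
`{|x| ≤ 1} × 𝕊₀ ∩ {tr Y² ≤ 601}` (certificate j214521: box K by the Hessian argument + the 438 cells, Lemmas A–D of
`L3-S1-LEMMAS.md`). HYPOTHESIS = the engine-certified claim, NOT proved in these files and NOT a ledger statement
item (cell ruling of 2026-08-24: the engine legs stay `Prop` hypotheses of the conditional reduction). A closed
`Prop`; reduced downstream to `R18_S1chart` (`R18_S1near_of_chart`). [ours; hypothesis] -/
def R18_S1near : Prop :=
  ∀ (x : Vec3) (Y : Mat3), Y.IsSymm → Y.trace = 0 → x ⬝ᵥ x ≤ 1 → qF Y ≤ 601 → 0 ≤ W x Y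

/-- (S1) = (S1) NEAR + the kernel far-field theorem `W_nonneg_far`. [ours; glue] -/
theorem R18_S1_of_near (h : R18_S1near) : R18_S1 := fun x Y hY htr hx => by
  rcases le_total (qF Y) 601 with hle | hge
  · exact h x Y hY htr hx hle
  · exact W_nonneg_far x hY htr hx hge

end farS1

end R18

end Laminate

end Summit.NavierStokesRegularity.FunctionalMining

end
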